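import Literature.MathematicalPhysics.QuantumFieldTheory.Balaban1983to89.Beta.BorderedJets
import Mathlib.Analysis.Matrix.Normed
import Mathlib.Analysis.Calculus.FDeriv.Mul
import Mathlib.Analysis.Calculus.Deriv.Mul
import Mathlib.Analysis.Calculus.Deriv.Add
import Mathlib.Analysis.Calculus.Deriv.Comp
import Mathlib.Analysis.Normed.Ring.Units
import Mathlib.Analysis.RCLike.Basic

/-!
# `BalabanUV.Beta.GAN24.DerivativeRateTransferAnalyticKKT` — binder row G-an2-4 ∕ (CONV-C), route R6 «VALUES, NOT DERIVATIVES», PART 12: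
# THE KKT DICTIONARY — an1's BORDERED JETS **ARE** THE DERIVATIVES OF THE BLOCKS OF `M_k(B)⁻¹` ALONG A BACKGROUND LINE.
# `jet₁` is the derivative of `s ↦ (kkt (H + sH₁) (Q + sQ₁))⁻¹` (any scalar field `𝕜 = ℝ, ℂ`), the block read-outs `dFlucCov ∕ dMinOp ∕
# dMinOpL ∕ dEffForm` are the derivatives of `𝒢 ∕ ℋ ∕ ℋᴸ ∕ 𝒮`, the derivative of `jet₁` is the POLARISED `jet₂ δ δ′ + jet₂ δ′ δ`, so the pure
# second and the MIXED second derivatives of the effective form ∕ minimiser entries are an1's two-vertex words BY NAME (unit b2b-balaban-gan24-p3, gen 35; v1)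

NOT IN PRINT; OUR PROOF (for the ROUTE; [folklore] matrix calculus — Mathlib's `hasFDerivAt_ringInverse` ∕ `DifferentiableAt.inverse` on the
complete normed algebra `Matrix n n 𝕜` with the scoped `L∞`-operator norm `Matrix.Norms.Operator` (the pattern of road FP's `FP/MatrixInvDeriv`,
in the tree, for REAL curves of complex matrices, and of an2's `KKTInverseRegularity` for `C^k` over `ℝ`; here along a `𝕜`-line and on a
`𝕜`-normed parameter space for ANY `RCLike 𝕜`, so `𝕜 = ℂ` = route R6's holomorphic currency and `𝕜 = ℝ` = the road-FP ∕ an1 ∕ an2 currency at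
once) over an1's `Beta.BorderedJets` ∕ `Beta.CompositionSingular` BY NAME).  HONEST FRAMING (cell contract, verbatim): «discharging `BetaPertH`
makes Bałaban's UV stability UNCONDITIONAL — a real constructive-QFT result; it is NOT the continuum limit and NOT the Clay problem.»  HONEST
DEPENDENCY (verbatim): «continuum YM on T⁴ ⇐ BetaPertH ∧ nine spine estimates (0/9 proved); BetaPertH ⇐ (D1) ∧ (D4) ∧ CAP+tail; G-an2-4
gates asym, D1 and NE2/3/4.»
WHY THIS FILE (the desk's standing price of route R6, PRICING-GAN24 v3.26–v3.28 «R6»: «debt = S1 + S2 as a DICTIONARY to Bałaban's `M_k(B(s,t))`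
… no Bałaban object»).  PARTs 7–11 transfer a VALUE rate to the rows `∂_s`, `∂_s²`, `∂_t∂_s` at the base point of ENTRY FAMILIES holomorphic on a
disc ∕ bidisc — but the cell's u-rows (AN1.md (MF′) T1–T8: `K_u, K_{uu′}, Q_u, Q_{uu′}` insertions) are written in an1's JET vocabulary: the blocks
`Γ = flucCov`, `Ξ = minOp`, `Σ = −effForm` of the bordered inverse `(kkt H Q)⁻¹ = M_k⁻¹` (`Beta.Envelope` v1.1 ∕ `Beta.CompositionSingular`) and their
first ∕ second B-jets `dMinOp`, `dEffForm`, `jet₂` with the explicit vertex forms `dℋ = −𝒢·δH·ℋ − ℋ·δQ·ℋ + 𝒢·δQᵀ·𝒮`, `d𝒮 = ℋᴸ·δH·ℋ − 𝒮·δQ·ℋ −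
ℋᴸ·δQᵀ·𝒮`, `−(jet₂ δ δ′)₂₂ = (ℋᴸδH − 𝒮δQ)·dℋ(δ′) − ℋᴸδQᵀ·d𝒮(δ′)` (`Beta.BorderedJets` p185768, purely algebraic, exact remainders, NO
derivative statement).  THIS FILE is the missing identification: along the background LINE of bordered data `s ↦ (H + s·H₁, Q + s·Q₁)` (both the
Hessian AND the averaging constraint vary, as in `BorderedJets`) and the two-direction family `(s,t) ↦ (H + s·H₁ + t·H₂, Q + s·Q₁ + t·Q₂)` (route R6's
two-bond family), the analytic route's rows ARE an1's jets — so every row PARTs 7–11 estimate is, letter for letter, a (MF′) u-row constituent of the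
finite-dimensional model.
WHAT THIS FILE PROVES (0 sorry, 0 `def`; `𝕜` any `RCLike` field; `H H₁ H₂ : Matrix ν ν 𝕜`, `Q Q₁ Q₂ : Matrix μ ν 𝕜`; nonsingularity `IsUnit (kkt · ·).det`
ONLY AT THE POINT OF DIFFERENTIATION — openness of the nonsingular locus along a line is PROVED, §3):
* §1 [folklore] matrix calculus: `hasDerivAt_entry` ∕ `hasDerivAt_of_entries` (matrix-valued ⇄ entrywise along a `𝕜`-line), **`hasDerivAt_matrix_inv`**
  (`(A⁻¹)′ = −A⁻¹·A′·A⁻¹` where `det A(t)` is a unit), and on a normed parameter space `E`: `differentiableAt_matrix_of_entries`, `differentiableAt_entry`,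
  **`differentiableAt_inv_entry`** (entries of `y ↦ (A y)⁻¹` are `𝕜`-differentiable at a nonsingular point — for `𝕜 = ℂ`, `E = ℂ × ℂ` this is the
  joint holomorphy PART 8 asks of the two-bond family; PART 13 consumes it).
* §2 THE LINE: `kkt_affine` (`kkt (H + sH₁) (Q + sQ₁) = kkt H Q + s·kkt H₁ Q₁`), `hasDerivAt_kkt_affine`, **`hasDerivAt_kktInv_affine`** — an1's
  `jet₁ (H + s₀H₁) (Q + s₀Q₁) H₁ Q₁` IS the derivative of `s ↦ (kkt (H + sH₁) (Q + sQ₁))⁻¹` at `s₀` — and the four block read-outs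
  **`hasDerivAt_flucCov_affine ∕ hasDerivAt_minOp_affine ∕ hasDerivAt_minOpL_affine ∕ hasDerivAt_effForm_affine`** (derivatives of the ENTRIES of
  `𝒢, ℋ, ℋᴸ, 𝒮` = the entries of `dFlucCov, dMinOp, dMinOpL, dEffForm`), with the `deriv … 0 = …` forms `deriv_minOp_affine` ∕ `deriv_effForm_affine`.
* §3 SECOND ORDER: `continuous_det_kkt_affine`, `eventually_isUnit_det_kkt_affine` (the nonsingular locus is open along the line — no extra hypothesis),
  **`hasDerivAt_jet₁_affine`** (the derivative of `s ↦ jet₁ (H + sH₁) (Q + sQ₁) H′ Q′` is the POLARISED second jet `jet₂ δ δ′ + jet₂ δ′ δ`; diagonal: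
  `2 • jet₂ δ δ`, `hasDerivAt_jet₁_affine_diag`), hence **`deriv_deriv_effForm_affine`** ∕ **`deriv_deriv_minOp_affine`** (PURE second derivative of an
  effective-form ∕ minimiser entry along the line = TWICE an1's two-vertex word `(ℋᴸH₁ − 𝒮Q₁)·dℋ(1) − ℋᴸQ₁ᵀ·d𝒮(1)`, resp. `−(𝒢H₁ + ℋQ₁)·dℋ(1) + 𝒢Q₁ᵀ·d𝒮(1)`
  — the `t²`-coefficient of `minOp_effForm_line_taylor₂` with no second-order vertex) and **`deriv_deriv_effForm_affine₂`** ∕ **`deriv_deriv_minOp_affine₂`**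
  (the MIXED derivative `∂_t∂_s` at `(0,0)` of an entry along `(H + sH₁ + tH₂, Q + sQ₁ + tQ₂)` = the SUM of the two polarised two-vertex words — route R6's
  mixed u-row of PART 8 in an1's letters).
WHAT IT DOES NOT DO: any SIZE statement (k-uniform bounds, decay, radius — S1 ∕ S2 ∕ (H2) of the route stay displayed hypotheses of PARTs 7–11 ∕ 13); the
identification of an1's model data `(H, Q; H₁, Q₁)` with Bałaban's lattice operators and their B-jets (an3's `PlaquetteVertex` ∕ an2's `AffineAveraging` —
(T-def)'s business, `BorderedJets` docstring (c)) — this is a dictionary to an1's JETS; WHICH `(H,Q)`-line is the background family `B(s,t)` of [B12]'s printed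
one-step operator `M_k(B)` is NOT asserted here (gan24-idea-1 W-idea1-g32-1); nothing of Bałaban's is asserted.  SUPPLIER work on route R6 (rank 2, KEEP-AS-REDUCTION, no seat); NEVER
«G-an2-4 closed»; NOT (CONV-C), NOT D1, NOT `BetaPertH`, NOT continuum, NOT Clay.  Records: `HOME/b2b-balaban-gan24-p3/WOODBURY-FIBRE.md` v13.5.
-/

noncomputable section

namespace Summit.QuantumFields.BalabanUV.Beta.GAN24.DerivativeRateTransferAnalyticKKT

open Matrix Filter
open scoped Matrix.Norms.Operator Topology
open Literature.MathematicalPhysics.QuantumFieldTheory.Balaban1983to89.Beta.Composition (kkt)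
open Literature.MathematicalPhysics.QuantumFieldTheory.Balaban1983to89.Beta.CompositionSingular
  (flucCov minOp minOpL effForm)
open Literature.MathematicalPhysics.QuantumFieldTheory.Balaban1983to89.Beta.BorderedJets
  (dressed jet₁ jet₂ dFlucCov dMinOp dMinOpL dEffForm kkt_add kkt_smul jet₂_toBlocks₁₂ neg_jet₂_toBlocks₂₂)

/-! ## §1 Matrix calculus over an `RCLike` field: entries, and the inverse at a nonsingular point -/

section MatrixCalculus

variable {𝕜 : Type*} [RCLike 𝕜]
variable {m n : Type*} [Fintype m] [Fintype n]

/-- [folklore] a matrix-valued derivative along a `𝕜`-line gives the derivative of every entry (entry evaluation is a continuous linear map). -/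
theorem hasDerivAt_entry {A : 𝕜 → Matrix m n 𝕜} {A' : Matrix m n 𝕜} {t : 𝕜} (h : HasDerivAt A A' t) (i : m) (j : n) :
    HasDerivAt (fun s => A s i j) (A' i j) t := by
  set L : Matrix m n 𝕜 →L[𝕜] 𝕜 := LinearMap.toContinuousLinearMap (Matrix.entryLinearMap 𝕜 𝕜 i j) with hL
  have h2 : HasDerivAt (fun s => L (A s)) (L A') t := L.hasFDerivAt.comp_hasDerivAt t h
  exact h2

variable [DecidableEq m] [DecidableEq n]

/-- [folklore] ENTRYWISE DERIVATIVES GIVE THE MATRIX-VALUED DERIVATIVE along a `𝕜`-line (`A = Σ_{i,j} (A i j) • single i j 1`, finite sum). -/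
theorem hasDerivAt_of_entries {A : 𝕜 → Matrix m n 𝕜} {A' : Matrix m n 𝕜} {t : 𝕜}
    (h : ∀ i j, HasDerivAt (fun s => A s i j) (A' i j) t) : HasDerivAt A A' t := by
  have hdec : ∀ M : Matrix m n 𝕜, M = ∑ i, ∑ j, M i j • Matrix.single i j (1 : 𝕜) := fun M => by
    conv_lhs => rw [Matrix.matrix_eq_sum_single M]
    refine Finset.sum_congr rfl fun i _ => Finset.sum_congr rfl fun j _ => ?_
    rw [Matrix.smul_single, smul_eq_mul, mul_one]
  have hA : A = fun s => ∑ i, ∑ j, A s i j • Matrix.single i j (1 : 𝕜) := funext fun s => hdec (A s)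
  rw [hA, hdec A']
  refine HasDerivAt.fun_sum fun i _ => ?_
  refine HasDerivAt.fun_sum fun j _ => ?_
  exact (h i j).smul_const (Matrix.single i j (1 : 𝕜))

/-- [folklore] **DERIVATIVE OF THE INVERSE ALONG A `𝕜`-LINE OF MATRICES**: `(A⁻¹)′ = −A⁻¹·A′·A⁻¹` at a point where `det A` is a unit
(Mathlib `hasFDerivAt_ringInverse` on the complete normed algebra `Matrix n n 𝕜`; `Matrix.nonsing_inv_eq_ringInverse`). -/
theorem hasDerivAt_matrix_inv {A : 𝕜 → Matrix n n 𝕜} {A' : Matrix n n 𝕜} {t : 𝕜}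
    (h : HasDerivAt A A' t) (hdet : IsUnit (A t).det) :
    HasDerivAt (fun s => (A s)⁻¹) (-((A t)⁻¹ * A' * (A t)⁻¹)) t := by
  haveI : CompleteSpace (Matrix n n 𝕜) := FiniteDimensional.complete 𝕜 (Matrix n n 𝕜)
  obtain ⟨u, hu⟩ := (Matrix.isUnit_iff_isUnit_det _).2 hdet
  have key := hasFDerivAt_ringInverse (𝕜 := 𝕜) u
  rw [hu] at key
  have h2 := key.comp_hasDerivAt t h
  simp only [_root_.neg_apply, ContinuousLinearMap.mulLeftRight_apply] at h2
  have hinv : ((u⁻¹ : (Matrix n n 𝕜)ˣ) : Matrix n n 𝕜) = (A t)⁻¹ := by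
    rw [Matrix.coe_units_inv, hu]
  rw [hinv] at h2
  refine h2.congr_of_eventuallyEq (Eventually.of_forall fun s => ?_)
  exact Matrix.nonsing_inv_eq_ringInverse (A s)

variable {E : Type*} [NormedAddCommGroup E] [NormedSpace 𝕜 E]

omit [DecidableEq m] [DecidableEq n] in
/-- [folklore] a `𝕜`-differentiable matrix-valued map on a normed space has `𝕜`-differentiable entries. -/
theorem differentiableAt_entry {A : E → Matrix m n 𝕜} {x : E} (h : DifferentiableAt 𝕜 A x) (i : m) (j : n) :
    DifferentiableAt 𝕜 (fun y => A y i j) x := by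
  set L : Matrix m n 𝕜 →L[𝕜] 𝕜 := LinearMap.toContinuousLinearMap (Matrix.entryLinearMap 𝕜 𝕜 i j) with hL
  have h2 : DifferentiableAt 𝕜 (fun y => L (A y)) x := L.differentiableAt.comp x h
  exact h2

/-- [folklore] entrywise `𝕜`-differentiability on a normed parameter space gives matrix-valued differentiability. -/
theorem differentiableAt_matrix_of_entries {A : E → Matrix m n 𝕜} {x : E}
    (h : ∀ i j, DifferentiableAt 𝕜 (fun y => A y i j) x) : DifferentiableAt 𝕜 A x := by
  have hdec : ∀ M : Matrix m n 𝕜, M = ∑ i, ∑ j, M i j • Matrix.single i j (1 : 𝕜) := fun M => by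
    conv_lhs => rw [Matrix.matrix_eq_sum_single M]
    refine Finset.sum_congr rfl fun i _ => Finset.sum_congr rfl fun j _ => ?_
    rw [Matrix.smul_single, smul_eq_mul, mul_one]
  have hA : A = fun y => ∑ i, ∑ j, A y i j • Matrix.single i j (1 : 𝕜) := funext fun y => hdec (A y)
  rw [hA]
  refine DifferentiableAt.fun_sum fun i _ => ?_
  refine DifferentiableAt.fun_sum fun j _ => ?_
  exact (h i j).smul_const (Matrix.single i j (1 : 𝕜))

/-- [folklore] **ENTRIES OF THE INVERSE ARE `𝕜`-DIFFERENTIABLE AT A NONSINGULAR POINT** of a normed parameter space `E` (for `𝕜 = ℂ`: holomorphic;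
`E = ℂ × ℂ` is route R6's two-bond parameter space) — from ENTRYWISE differentiability of `A` (Mathlib `DifferentiableAt.inverse` on the complete
normed algebra `Matrix n n 𝕜`; the matrix norm enters NO statement). -/
theorem differentiableAt_inv_entry {A : E → Matrix n n 𝕜} {x : E} (h : ∀ i j, DifferentiableAt 𝕜 (fun y => A y i j) x)
    (hdet : IsUnit (A x).det) (k l : n) : DifferentiableAt 𝕜 (fun y => (A y)⁻¹ k l) x := by
  haveI : CompleteSpace (Matrix n n 𝕜) := FiniteDimensional.complete 𝕜 (Matrix n n 𝕜)
  have hA : DifferentiableAt 𝕜 A x := differentiableAt_matrix_of_entries h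
  have hinv : DifferentiableAt 𝕜 (fun y => Ring.inverse (A y)) x := hA.inverse ((Matrix.isUnit_iff_isUnit_det _).2 hdet)
  have hinv' : DifferentiableAt 𝕜 (fun y => (A y)⁻¹) x :=
    hinv.congr_of_eventuallyEq (Eventually.of_forall fun y => Matrix.nonsing_inv_eq_ringInverse (A y))
  exact differentiableAt_entry hinv' k l

end MatrixCalculus

/-! ## §2 The background LINE of bordered data `s ↦ (H + sH₁, Q + sQ₁)`: `jet₁` is the derivative of the bordered inverse -/

section Line

variable {𝕜 : Type*} [RCLike 𝕜]
variable {ν μ : Type*} [Fintype ν] [Fintype μ]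
variable (H H₁ : Matrix ν ν 𝕜) (Q Q₁ : Matrix μ ν 𝕜)

omit [Fintype ν] [Fintype μ] in
/-- [folklore] the bordered matrix is AFFINE along the line: `kkt (H + sH₁) (Q + sQ₁) = kkt H Q + s • kkt H₁ Q₁` (an1's `kkt_add`, `kkt_smul`). -/
theorem kkt_affine (s : 𝕜) : kkt (H + s • H₁) (Q + s • Q₁) = kkt H Q + s • kkt H₁ Q₁ := by
  rw [kkt_add, kkt_smul]

/-- [folklore] the bordered line has derivative the bordered VERTEX `kkt H₁ Q₁` at every point. -/
theorem hasDerivAt_kkt_affine (s₀ : 𝕜) :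
    HasDerivAt (fun s : 𝕜 => kkt (H + s • H₁) (Q + s • Q₁)) (kkt H₁ Q₁) s₀ := by
  have h1 : HasDerivAt (fun s : 𝕜 => s • kkt H₁ Q₁) ((1 : 𝕜) • kkt H₁ Q₁) s₀ :=
    (hasDerivAt_id s₀).smul_const (kkt H₁ Q₁)
  rw [one_smul] at h1
  have h := h1.const_add (kkt H Q)
  refine h.congr_of_eventuallyEq (Eventually.of_forall fun s => ?_)
  exact kkt_affine H H₁ Q Q₁ s

variable [DecidableEq ν] [DecidableEq μ]

/-- **`hasDerivAt_kktInv_affine` — an1's FIRST B-JET IS THE DERIVATIVE OF THE BORDERED INVERSE** [our proof]: at any `s₀` where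
`kkt (H + s₀H₁) (Q + s₀Q₁)` is nonsingular, `s ↦ (kkt (H + sH₁) (Q + sQ₁))⁻¹` has derivative `BorderedJets.jet₁ (H + s₀H₁) (Q + s₀Q₁) H₁ Q₁ =
−(kkt⁻¹ · kkt H₁ Q₁ · kkt⁻¹)` there (any `RCLike 𝕜`: `ℂ` for route R6, `ℝ` for an1 ∕ an2 ∕ road FP). -/
theorem hasDerivAt_kktInv_affine {s₀ : 𝕜} (h : IsUnit (kkt (H + s₀ • H₁) (Q + s₀ • Q₁)).det) :
    HasDerivAt (fun s : 𝕜 => (kkt (H + s • H₁) (Q + s • Q₁))⁻¹) (jet₁ (H + s₀ • H₁) (Q + s₀ • Q₁) H₁ Q₁) s₀ := by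
  have hd := hasDerivAt_matrix_inv (hasDerivAt_kkt_affine H H₁ Q Q₁ s₀) h
  convert hd using 1
  simp only [jet₁, dressed]

/-- **`hasDerivAt_kktInv_affine_zero`** — the same AT THE BASE POINT: derivative `jet₁ H Q H₁ Q₁` at `s = 0` from `IsUnit (kkt H Q).det`. [our proof] -/
theorem hasDerivAt_kktInv_affine_zero (h : IsUnit (kkt H Q).det) :
    HasDerivAt (fun s : 𝕜 => (kkt (H + s • H₁) (Q + s • Q₁))⁻¹) (jet₁ H Q H₁ Q₁) 0 := by
  have h0 : IsUnit (kkt (H + (0 : 𝕜) • H₁) (Q + (0 : 𝕜) • Q₁)).det := by simpa using h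
  simpa using hasDerivAt_kktInv_affine H H₁ Q Q₁ h0

/-- **THE FLUCTUATION-COVARIANCE ROW**: the entries of `s ↦ 𝒢(s) = flucCov (H + sH₁) (Q + sQ₁)` have derivatives the entries of an1's
`dFlucCov = −𝒢·δH·𝒢 − ℋ·δQ·𝒢 − 𝒢·δQᵀ·ℋᴸ` (`BorderedJets.dFlucCov_eq`). [our proof] -/
theorem hasDerivAt_flucCov_affine {s₀ : 𝕜} (h : IsUnit (kkt (H + s₀ • H₁) (Q + s₀ • Q₁)).det) (i j : ν) :
    HasDerivAt (fun s : 𝕜 => flucCov (H + s • H₁) (Q + s • Q₁) i j)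
      (dFlucCov (H + s₀ • H₁) (Q + s₀ • Q₁) H₁ Q₁ i j) s₀ :=
  hasDerivAt_entry (hasDerivAt_kktInv_affine H H₁ Q Q₁ h) (Sum.inl i) (Sum.inl j)

/-- **THE MINIMISER ROW**: the entries of `s ↦ ℋ(s) = minOp (H + sH₁) (Q + sQ₁)` have derivatives the entries of an1's
`dMinOp = −𝒢·δH·ℋ − ℋ·δQ·ℋ + 𝒢·δQᵀ·𝒮` (`BorderedJets.dMinOp_eq`). [our proof] -/
theorem hasDerivAt_minOp_affine {s₀ : 𝕜} (h : IsUnit (kkt (H + s₀ • H₁) (Q + s₀ • Q₁)).det) (i : ν) (j : μ) :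
    HasDerivAt (fun s : 𝕜 => minOp (H + s • H₁) (Q + s • Q₁) i j)
      (dMinOp (H + s₀ • H₁) (Q + s₀ • Q₁) H₁ Q₁ i j) s₀ :=
  hasDerivAt_entry (hasDerivAt_kktInv_affine H H₁ Q Q₁ h) (Sum.inl i) (Sum.inr j)

/-- **THE LEFT-MINIMISER ROW**: entries of `s ↦ ℋᴸ(s)` have derivatives the entries of `dMinOpL` (`BorderedJets.dMinOpL_eq`). [our proof] -/
theorem hasDerivAt_minOpL_affine {s₀ : 𝕜} (h : IsUnit (kkt (H + s₀ • H₁) (Q + s₀ • Q₁)).det) (i : μ) (j : ν) :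
    HasDerivAt (fun s : 𝕜 => minOpL (H + s • H₁) (Q + s • Q₁) i j)
      (dMinOpL (H + s₀ • H₁) (Q + s₀ • Q₁) H₁ Q₁ i j) s₀ :=
  hasDerivAt_entry (hasDerivAt_kktInv_affine H H₁ Q Q₁ h) (Sum.inr i) (Sum.inl j)

/-- **THE EFFECTIVE-FORM ROW (the β-function's block)**: the entries of `s ↦ 𝒮(s) = effForm (H + sH₁) (Q + sQ₁)` have derivatives the entries of
an1's `dEffForm = ℋᴸ·δH·ℋ − 𝒮·δQ·ℋ − ℋᴸ·δQᵀ·𝒮` (`BorderedJets.dEffForm_eq`; HELLMANN–FEYNMAN `ℋᴸ·δH·ℋ` when `δQ = 0`). [our proof] -/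
theorem hasDerivAt_effForm_affine {s₀ : 𝕜} (h : IsUnit (kkt (H + s₀ • H₁) (Q + s₀ • Q₁)).det) (i j : μ) :
    HasDerivAt (fun s : 𝕜 => effForm (H + s • H₁) (Q + s • Q₁) i j)
      (dEffForm (H + s₀ • H₁) (Q + s₀ • Q₁) H₁ Q₁ i j) s₀ :=
  (hasDerivAt_entry (hasDerivAt_kktInv_affine H H₁ Q Q₁ h) (Sum.inr i) (Sum.inr j)).neg

/-- `deriv` form AT THE BASE POINT for the minimiser: `deriv (s ↦ ℋ(s) i j) 0 = dMinOp H Q H₁ Q₁ i j`. [our proof] -/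
theorem deriv_minOp_affine (h : IsUnit (kkt H Q).det) (i : ν) (j : μ) :
    deriv (fun s : 𝕜 => minOp (H + s • H₁) (Q + s • Q₁) i j) 0 = dMinOp H Q H₁ Q₁ i j := by
  have h0 : IsUnit (kkt (H + (0 : 𝕜) • H₁) (Q + (0 : 𝕜) • Q₁)).det := by simpa using h
  simpa using (hasDerivAt_minOp_affine H H₁ Q Q₁ h0 i j).deriv

/-- `deriv` form AT THE BASE POINT for the effective form: `deriv (s ↦ 𝒮(s) i j) 0 = dEffForm H Q H₁ Q₁ i j`. [our proof] -/
theorem deriv_effForm_affine (h : IsUnit (kkt H Q).det) (i j : μ) :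
    deriv (fun s : 𝕜 => effForm (H + s • H₁) (Q + s • Q₁) i j) 0 = dEffForm H Q H₁ Q₁ i j := by
  have h0 : IsUnit (kkt (H + (0 : 𝕜) • H₁) (Q + (0 : 𝕜) • Q₁)).det := by simpa using h
  simpa using (hasDerivAt_effForm_affine H H₁ Q Q₁ h0 i j).deriv

/-- `deriv` form AT THE BASE POINT for the fluctuation covariance: `deriv (s ↦ 𝒢(s) i j) 0 = dFlucCov H Q H₁ Q₁ i j`. [our proof] -/
theorem deriv_flucCov_affine (h : IsUnit (kkt H Q).det) (i j : ν) :
    deriv (fun s : 𝕜 => flucCov (H + s • H₁) (Q + s • Q₁) i j) 0 = dFlucCov H Q H₁ Q₁ i j := by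
  have h0 : IsUnit (kkt (H + (0 : 𝕜) • H₁) (Q + (0 : 𝕜) • Q₁)).det := by simpa using h
  simpa using (hasDerivAt_flucCov_affine H H₁ Q Q₁ h0 i j).deriv

end Line

/-! ## §3 Second order: the nonsingular locus is open along the line; the derivative of `jet₁` is the polarised `jet₂`; pure and MIXED rows -/

section SecondOrder

variable {𝕜 : Type*} [RCLike 𝕜]
variable {ν μ : Type*} [Fintype ν] [Fintype μ] [DecidableEq ν] [DecidableEq μ]
variable (H H₁ H₂ : Matrix ν ν 𝕜) (Q Q₁ Q₂ : Matrix μ ν 𝕜)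

/-- [folklore] `s ↦ det (kkt (H + sH₁) (Q + sQ₁))` is continuous (a polynomial in `s`: Leibniz expansion with affine entries; no matrix norm). -/
theorem continuous_det_kkt_affine : Continuous fun s : 𝕜 => (kkt (H + s • H₁) (Q + s • Q₁)).det := by
  simp only [kkt_affine, Matrix.det_apply']
  refine continuous_finsetSum _ fun σ _ => continuous_const.mul (continuous_finsetProd _ fun i _ => ?_)
  simp only [Matrix.add_apply, Matrix.smul_apply, smul_eq_mul]
  exact continuous_const.add (continuous_id.mul continuous_const)

/-- [folklore] **THE NONSINGULAR LOCUS IS OPEN ALONG THE LINE**: `IsUnit (kkt H Q).det` ⇒ `kkt (H + sH₁) (Q + sQ₁)` is nonsingular for all `s`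
near `0` (so the second-order read-outs below need NO hypothesis beyond the base point). -/
theorem eventually_isUnit_det_kkt_affine (h : IsUnit (kkt H Q).det) :
    ∀ᶠ s in 𝓝 (0 : 𝕜), IsUnit (kkt (H + s • H₁) (Q + s • Q₁)).det := by
  have h0 : (kkt (H + (0 : 𝕜) • H₁) (Q + (0 : 𝕜) • Q₁)).det ≠ 0 := by simpa using h.ne_zero
  exact ((continuous_det_kkt_affine H H₁ Q Q₁).continuousAt.eventually_ne h0).mono fun s hs => isUnit_iff_ne_zero.2 hs

/-- **`hasDerivAt_jet₁_affine` — THE DERIVATIVE OF THE FIRST JET IS THE POLARISED SECOND JET** [our proof]: for a fixed vertex `(H′, Q′)`, at any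
nonsingular `s₀` of the line, `s ↦ jet₁ (H + sH₁) (Q + sQ₁) H′ Q′ = −kkt(s)⁻¹·kkt H′ Q′·kkt(s)⁻¹` has derivative
`jet₂ (…) H₁ Q₁ H′ Q′ + jet₂ (…) H′ Q′ H₁ Q₁ = X(δ)X(δ′)kkt⁻¹ + X(δ′)X(δ)kkt⁻¹` (product rule + §2; `δ = (H₁,Q₁)` the line's direction). -/
theorem hasDerivAt_jet₁_affine (H' : Matrix ν ν 𝕜) (Q' : Matrix μ ν 𝕜) {s₀ : 𝕜}
    (h : IsUnit (kkt (H + s₀ • H₁) (Q + s₀ • Q₁)).det) :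
    HasDerivAt (fun s : 𝕜 => jet₁ (H + s • H₁) (Q + s • Q₁) H' Q')
      (jet₂ (H + s₀ • H₁) (Q + s₀ • Q₁) H₁ Q₁ H' Q' + jet₂ (H + s₀ • H₁) (Q + s₀ • Q₁) H' Q' H₁ Q₁) s₀ := by
  have hI := hasDerivAt_kktInv_affine H H₁ Q Q₁ h
  have hK' : HasDerivAt (fun _ : 𝕜 => kkt H' Q') 0 s₀ := hasDerivAt_const _ _
  have h3 : HasDerivAt (fun s : 𝕜 => -((kkt (H + s • H₁) (Q + s • Q₁))⁻¹ * kkt H' Q' * (kkt (H + s • H₁) (Q + s • Q₁))⁻¹))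
      (-((jet₁ (H + s₀ • H₁) (Q + s₀ • Q₁) H₁ Q₁ * kkt H' Q' + (kkt (H + s₀ • H₁) (Q + s₀ • Q₁))⁻¹ * 0)
          * (kkt (H + s₀ • H₁) (Q + s₀ • Q₁))⁻¹
        + (kkt (H + s₀ • H₁) (Q + s₀ • Q₁))⁻¹ * kkt H' Q' * jet₁ (H + s₀ • H₁) (Q + s₀ • Q₁) H₁ Q₁)) s₀ :=
    ((hI.mul hK').mul hI).neg
  refine (h3.congr_of_eventuallyEq (Eventually.of_forall fun s => ?_)).congr_deriv ?_
  · simp only [jet₁, dressed]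
  · simp only [Matrix.mul_zero, add_zero, jet₂, jet₁, dressed, neg_mul, mul_neg, neg_add, neg_neg, Matrix.mul_assoc]

/-- **`hasDerivAt_jet₁_affine_diag`** — the DIAGONAL case `(H′, Q′) = (H₁, Q₁)`: derivative `2 • jet₂ (…) H₁ Q₁ H₁ Q₁` (so the second derivative of the
bordered inverse along the line is twice an1's diagonal second jet — the `t²`-coefficient of `kktInv_line_taylor₂` with no second-order vertex). [our proof] -/
theorem hasDerivAt_jet₁_affine_diag {s₀ : 𝕜} (h : IsUnit (kkt (H + s₀ • H₁) (Q + s₀ • Q₁)).det) :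
    HasDerivAt (fun s : 𝕜 => jet₁ (H + s • H₁) (Q + s • Q₁) H₁ Q₁)
      ((2 : 𝕜) • jet₂ (H + s₀ • H₁) (Q + s₀ • Q₁) H₁ Q₁ H₁ Q₁) s₀ := by
  rw [two_smul]
  exact hasDerivAt_jet₁_affine H H₁ Q Q₁ H₁ Q₁ h

/-- [our proof] near the base point, the derivative of an effective-form entry along the line IS the `dEffForm` entry AS A FUNCTION of the line
parameter (§2 at every nearby point, which is nonsingular by `eventually_isUnit_det_kkt_affine`). -/
theorem deriv_effForm_affine_eventuallyEq (h : IsUnit (kkt H Q).det) (i j : μ) :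
    (fun s : 𝕜 => deriv (fun s' : 𝕜 => effForm (H + s' • H₁) (Q + s' • Q₁) i j) s) =ᶠ[𝓝 (0 : 𝕜)]
      fun s : 𝕜 => dEffForm (H + s • H₁) (Q + s • Q₁) H₁ Q₁ i j :=
  (eventually_isUnit_det_kkt_affine H H₁ Q Q₁ h).mono fun _ hs => (hasDerivAt_effForm_affine H H₁ Q Q₁ hs i j).deriv

/-- [our proof] the same for the minimiser entries. -/
theorem deriv_minOp_affine_eventuallyEq (h : IsUnit (kkt H Q).det) (i : ν) (j : μ) :
    (fun s : 𝕜 => deriv (fun s' : 𝕜 => minOp (H + s' • H₁) (Q + s' • Q₁) i j) s) =ᶠ[𝓝 (0 : 𝕜)]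
      fun s : 𝕜 => dMinOp (H + s • H₁) (Q + s • Q₁) H₁ Q₁ i j :=
  (eventually_isUnit_det_kkt_affine H H₁ Q Q₁ h).mono fun _ hs => (hasDerivAt_minOp_affine H H₁ Q Q₁ hs i j).deriv

/-- **`hasDerivAt_dEffForm_affine`** — the `dEffForm` row along the line has derivative the `₂₂`-read-out of the polarised second jet:
`−(jet₂ δ δ′ + jet₂ δ′ δ)₂₂` (`δ′ = (H′,Q′)` the fixed vertex). [our proof] -/
theorem hasDerivAt_dEffForm_affine (H' : Matrix ν ν 𝕜) (Q' : Matrix μ ν 𝕜) {s₀ : 𝕜}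
    (h : IsUnit (kkt (H + s₀ • H₁) (Q + s₀ • Q₁)).det) (i j : μ) :
    HasDerivAt (fun s : 𝕜 => dEffForm (H + s • H₁) (Q + s • Q₁) H' Q' i j)
      (-((jet₂ (H + s₀ • H₁) (Q + s₀ • Q₁) H₁ Q₁ H' Q' + jet₂ (H + s₀ • H₁) (Q + s₀ • Q₁) H' Q' H₁ Q₁)
        (Sum.inr i) (Sum.inr j))) s₀ :=
  (hasDerivAt_entry (hasDerivAt_jet₁_affine H H₁ Q Q₁ H' Q' h) (Sum.inr i) (Sum.inr j)).neg

/-- **`hasDerivAt_dMinOp_affine`** — the `dMinOp` row along the line has derivative the `₁₂`-read-out of the polarised second jet. [our proof] -/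
theorem hasDerivAt_dMinOp_affine (H' : Matrix ν ν 𝕜) (Q' : Matrix μ ν 𝕜) {s₀ : 𝕜}
    (h : IsUnit (kkt (H + s₀ • H₁) (Q + s₀ • Q₁)).det) (i : ν) (j : μ) :
    HasDerivAt (fun s : 𝕜 => dMinOp (H + s • H₁) (Q + s • Q₁) H' Q' i j)
      ((jet₂ (H + s₀ • H₁) (Q + s₀ • Q₁) H₁ Q₁ H' Q' + jet₂ (H + s₀ • H₁) (Q + s₀ • Q₁) H' Q' H₁ Q₁)
        (Sum.inl i) (Sum.inr j)) s₀ :=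
  hasDerivAt_entry (hasDerivAt_jet₁_affine H H₁ Q Q₁ H' Q' h) (Sum.inl i) (Sum.inr j)

/-- **`deriv_deriv_effForm_affine` — THE PURE SECOND u-ROW OF THE EFFECTIVE FORM IN an1's LETTERS** [our proof]: from `IsUnit (kkt H Q).det` alone,
`∂_s²|₀ 𝒮(H + sH₁, Q + sQ₁) i j = 2·((ℋᴸH₁ − 𝒮Q₁)·dℋ(H₁,Q₁) − ℋᴸQ₁ᵀ·d𝒮(H₁,Q₁)) i j` — twice the two-vertex word of `minOp_effForm_line_taylor₂`
(`BorderedJets.neg_jet₂_toBlocks₂₂`). -/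
theorem deriv_deriv_effForm_affine (h : IsUnit (kkt H Q).det) (i j : μ) :
    deriv (fun s : 𝕜 => deriv (fun s' : 𝕜 => effForm (H + s' • H₁) (Q + s' • Q₁) i j) s) 0 =
      2 * ((minOpL H Q * H₁ - effForm H Q * Q₁) * dMinOp H Q H₁ Q₁ - minOpL H Q * Q₁ᵀ * dEffForm H Q H₁ Q₁) i j := by
  rw [(deriv_effForm_affine_eventuallyEq H H₁ Q Q₁ h i j).deriv_eq]
  have h0 : IsUnit (kkt (H + (0 : 𝕜) • H₁) (Q + (0 : 𝕜) • Q₁)).det := by simpa using h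
  have hd := (hasDerivAt_dEffForm_affine H H₁ Q Q₁ H₁ Q₁ h0 i j).deriv
  rw [hd, ← neg_jet₂_toBlocks₂₂]
  simp only [zero_smul, add_zero, Matrix.add_apply, Matrix.neg_apply, Matrix.toBlocks₂₂, Matrix.of_apply]
  ring

/-- **`deriv_deriv_minOp_affine` — THE PURE SECOND u-ROW OF THE MINIMISER IN an1's LETTERS** [our proof]:
`∂_s²|₀ ℋ(H + sH₁, Q + sQ₁) i j = 2·(−(𝒢H₁ + ℋQ₁)·dℋ(H₁,Q₁) + 𝒢Q₁ᵀ·d𝒮(H₁,Q₁)) i j` (`BorderedJets.jet₂_toBlocks₁₂`). -/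
theorem deriv_deriv_minOp_affine (h : IsUnit (kkt H Q).det) (i : ν) (j : μ) :
    deriv (fun s : 𝕜 => deriv (fun s' : 𝕜 => minOp (H + s' • H₁) (Q + s' • Q₁) i j) s) 0 =
      2 * (-((flucCov H Q * H₁ + minOp H Q * Q₁) * dMinOp H Q H₁ Q₁) + flucCov H Q * Q₁ᵀ * dEffForm H Q H₁ Q₁) i j := by
  rw [(deriv_minOp_affine_eventuallyEq H H₁ Q Q₁ h i j).deriv_eq]
  have h0 : IsUnit (kkt (H + (0 : 𝕜) • H₁) (Q + (0 : 𝕜) • Q₁)).det := by simpa using h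
  have hd := (hasDerivAt_dMinOp_affine H H₁ Q Q₁ H₁ Q₁ h0 i j).deriv
  rw [hd, ← jet₂_toBlocks₁₂]
  simp only [zero_smul, add_zero, Matrix.add_apply, Matrix.toBlocks₁₂, Matrix.of_apply]
  ring

/-- [our proof] the two-direction family READ AS A LINE IN `s` AT FIXED `t`: for `t` near `0`, the `s`-derivative at `s = 0` of an effective-form entry
along `(H + sH₁ + tH₂, Q + sQ₁ + tQ₂)` is the `dEffForm (H + tH₂) (Q + tQ₂) H₁ Q₁` entry. -/
theorem deriv_effForm_affine₂_eventuallyEq (h : IsUnit (kkt H Q).det) (i j : μ) :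
    (fun t : 𝕜 => deriv (fun s : 𝕜 => effForm (H + s • H₁ + t • H₂) (Q + s • Q₁ + t • Q₂) i j) 0) =ᶠ[𝓝 (0 : 𝕜)]
      fun t : 𝕜 => dEffForm (H + t • H₂) (Q + t • Q₂) H₁ Q₁ i j := by
  refine (eventually_isUnit_det_kkt_affine H H₂ Q Q₂ h).mono fun t ht => ?_
  have hfun : (fun s : 𝕜 => effForm (H + s • H₁ + t • H₂) (Q + s • Q₁ + t • Q₂) i j) =
      fun s : 𝕜 => effForm (H + t • H₂ + s • H₁) (Q + t • Q₂ + s • Q₁) i j := by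
    funext s; rw [add_right_comm H, add_right_comm Q]
  simp only [hfun]
  exact deriv_effForm_affine (H + t • H₂) H₁ (Q + t • Q₂) Q₁ ht i j

/-- [our proof] the same for the minimiser entries. -/
theorem deriv_minOp_affine₂_eventuallyEq (h : IsUnit (kkt H Q).det) (i : ν) (j : μ) :
    (fun t : 𝕜 => deriv (fun s : 𝕜 => minOp (H + s • H₁ + t • H₂) (Q + s • Q₁ + t • Q₂) i j) 0) =ᶠ[𝓝 (0 : 𝕜)]
      fun t : 𝕜 => dMinOp (H + t • H₂) (Q + t • Q₂) H₁ Q₁ i j := by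
  refine (eventually_isUnit_det_kkt_affine H H₂ Q Q₂ h).mono fun t ht => ?_
  have hfun : (fun s : 𝕜 => minOp (H + s • H₁ + t • H₂) (Q + s • Q₁ + t • Q₂) i j) =
      fun s : 𝕜 => minOp (H + t • H₂ + s • H₁) (Q + t • Q₂ + s • Q₁) i j := by
    funext s; rw [add_right_comm H, add_right_comm Q]
  simp only [hfun]
  exact deriv_minOp_affine (H + t • H₂) H₁ (Q + t • Q₂) Q₁ ht i j

/-- **`deriv_deriv_effForm_affine₂` — ROUTE R6's MIXED u-ROW OF THE EFFECTIVE FORM IS THE SUM OF an1's TWO POLARISED TWO-VERTEX WORDS** [our proof]: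
from `IsUnit (kkt H Q).det` alone, along the two-direction family `(H + sH₁ + tH₂, Q + sQ₁ + tQ₂)`,
`∂_t∂_s|₍₀,₀₎ 𝒮 i j = (((ℋᴸH₂ − 𝒮Q₂)·dℋ(H₁,Q₁) − ℋᴸQ₂ᵀ·d𝒮(H₁,Q₁)) + ((ℋᴸH₁ − 𝒮Q₁)·dℋ(H₂,Q₂) − ℋᴸQ₁ᵀ·d𝒮(H₂,Q₂))) i j`
— exactly the row `deriv (t ↦ deriv (s ↦ F (s,t)) 0) 0` of PART 8's `derivMixed_step_rateω` for `F = 𝒮 i j`, in the letters of `BorderedJets`. -/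
theorem deriv_deriv_effForm_affine₂ (h : IsUnit (kkt H Q).det) (i j : μ) :
    deriv (fun t : 𝕜 => deriv (fun s : 𝕜 => effForm (H + s • H₁ + t • H₂) (Q + s • Q₁ + t • Q₂) i j) 0) 0 =
      (((minOpL H Q * H₂ - effForm H Q * Q₂) * dMinOp H Q H₁ Q₁ - minOpL H Q * Q₂ᵀ * dEffForm H Q H₁ Q₁)
        + ((minOpL H Q * H₁ - effForm H Q * Q₁) * dMinOp H Q H₂ Q₂ - minOpL H Q * Q₁ᵀ * dEffForm H Q H₂ Q₂)) i j := by
  rw [(deriv_effForm_affine₂_eventuallyEq H H₁ H₂ Q Q₁ Q₂ h i j).deriv_eq]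
  have h0 : IsUnit (kkt (H + (0 : 𝕜) • H₂) (Q + (0 : 𝕜) • Q₂)).det := by simpa using h
  have hd := (hasDerivAt_dEffForm_affine H H₂ Q Q₂ H₁ Q₁ h0 i j).deriv
  rw [hd, ← neg_jet₂_toBlocks₂₂, ← neg_jet₂_toBlocks₂₂]
  simp only [zero_smul, add_zero, Matrix.add_apply, Matrix.neg_apply, Matrix.toBlocks₂₂, Matrix.of_apply]
  ring

/-- **`deriv_deriv_minOp_affine₂` — THE MIXED u-ROW OF THE MINIMISER** [our proof]:
`∂_t∂_s|₍₀,₀₎ ℋ i j = ((−(𝒢H₂ + ℋQ₂)·dℋ(H₁,Q₁) + 𝒢Q₂ᵀ·d𝒮(H₁,Q₁)) + (−(𝒢H₁ + ℋQ₁)·dℋ(H₂,Q₂) + 𝒢Q₁ᵀ·d𝒮(H₂,Q₂))) i j`. -/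
theorem deriv_deriv_minOp_affine₂ (h : IsUnit (kkt H Q).det) (i : ν) (j : μ) :
    deriv (fun t : 𝕜 => deriv (fun s : 𝕜 => minOp (H + s • H₁ + t • H₂) (Q + s • Q₁ + t • Q₂) i j) 0) 0 =
      ((-((flucCov H Q * H₂ + minOp H Q * Q₂) * dMinOp H Q H₁ Q₁) + flucCov H Q * Q₂ᵀ * dEffForm H Q H₁ Q₁)
        + (-((flucCov H Q * H₁ + minOp H Q * Q₁) * dMinOp H Q H₂ Q₂) + flucCov H Q * Q₁ᵀ * dEffForm H Q H₂ Q₂)) i j := by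
  rw [(deriv_minOp_affine₂_eventuallyEq H H₁ H₂ Q Q₁ Q₂ h i j).deriv_eq]
  have h0 : IsUnit (kkt (H + (0 : 𝕜) • H₂) (Q + (0 : 𝕜) • Q₂)).det := by simpa using h
  have hd := (hasDerivAt_dMinOp_affine H H₂ Q Q₂ H₁ Q₁ h0 i j).deriv
  rw [hd, ← jet₂_toBlocks₁₂, ← jet₂_toBlocks₁₂]
  simp only [zero_smul, add_zero, Matrix.add_apply, Matrix.toBlocks₁₂, Matrix.of_apply]

end SecondOrder

end Summit.QuantumFields.BalabanUV.Beta.GAN24.DerivativeRateTransferAnalyticKKT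

end
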